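import Mathlib
import Summits.Ventures.PercRepro2.KPrimeLeafExt
import Summits.Ventures.PercRepro2.KPrimePendantMark

/-!
# Cycles and necklaces with `b` or `y` on a leaf (blind cell PercRepro2, mine-c g41;
`conjectures/MINE-C.md` §50.5)

The leaf extension `leafExt ends z` (`KPrimeLeafExt.lean`) with the LEAF in the role of `b` or
of `y`: by `kprimeHolds_of_pendant_b_at` / `kprimeHolds_of_pendant_y` (`KPrimePendantMark.lean`)
the cleared form scales by the leaf weight, so `(K′)` — and `(K′-T)` — at the leaf follow from
the `z`-instance, which is the base graph's statement transported (`kprimeHolds_leafExt`,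
`kprimeTHolds_leafExt`).  With `kprime_cycle_leaf` / `kprime_necklace_leaf` (`v` on a leaf) the
cycles and the necklaces are closed under hanging any of the three marks `b, v, y` on a leaf at
an unmarked vertex: `kprime_cycle_leaf_b`, `kprime_cycle_leaf_y`, `kprimeT_cycle_leaf_b`,
`kprimeT_cycle_leaf_y`, and the necklace versions.
-/

namespace Summit.Ventures.PercRepro2

namespace KPrimeCycle

open Cycle

section General

variable {V : Type*} {E : Type*} [Fintype E] [DecidableEq E] [Fintype V] [DecidableEq V]
  {R : Type*} [Field R] [LinearOrder R] [IsStrictOrderedRing R]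

omit [Fintype V] in
/-- `(K′)` with the leaf in the role of `b`, from the base graph's `(K′)` at `(a₁, a₂, z, v, y)`. -/
theorem kprime_leafExt_b (ends : E → Sym2 V) (z a₁ a₂ v y : V) (p : E ⊕ Unit → R)
    (hp : IsProbVec p) (H : KPrime.KPrimeHolds ends a₁ a₂ z v y (p ∘ Sum.inl)) :
    KPrime.KPrimeHolds (leafExt ends z) (Sum.inl a₁) (Sum.inl a₂) (Sum.inr ()) (Sum.inl v)
      (Sum.inl y) p :=
  KPrime.kprimeHolds_of_pendant_b_at hp (leafExt_leaf ends z) (by rw [leafExt_inr, Sym2.eq_swap])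
    Sum.inl_ne_inr Sum.inl_ne_inr Sum.inl_ne_inr Sum.inl_ne_inr Sum.inl_ne_inr
    ((kprimeHolds_leafExt ends z p a₁ a₂ z v y).1 H)

omit [Fintype V] in
/-- `(K′-T)` with the leaf in the role of `b`. -/
theorem kprimeT_leafExt_b (ends : E → Sym2 V) (z a₁ a₂ v y : V) (p : E ⊕ Unit → R)
    (hp : IsProbVec p) (H : KPrime.KPrimeTHolds ends a₁ a₂ z v y (p ∘ Sum.inl)) :
    KPrime.KPrimeTHolds (leafExt ends z) (Sum.inl a₁) (Sum.inl a₂) (Sum.inr ()) (Sum.inl v)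
      (Sum.inl y) p :=
  KPrime.kprimeTHolds_of_pendant_b_at hp (leafExt_leaf ends z)
    (by rw [leafExt_inr, Sym2.eq_swap]) Sum.inl_ne_inr Sum.inl_ne_inr Sum.inl_ne_inr
    Sum.inl_ne_inr Sum.inl_ne_inr ((kprimeTHolds_leafExt ends z p a₁ a₂ z v y).1 H)

omit [Fintype V] in
/-- `(K′)` with the leaf in the role of `y`, from the base graph's `(K′)` at `(a₁, a₂, b, v, z)`. -/
theorem kprime_leafExt_y (ends : E → Sym2 V) (z a₁ a₂ b v : V) (p : E ⊕ Unit → R)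
    (hp : IsProbVec p) (H : KPrime.KPrimeHolds ends a₁ a₂ b v z (p ∘ Sum.inl)) :
    KPrime.KPrimeHolds (leafExt ends z) (Sum.inl a₁) (Sum.inl a₂) (Sum.inl b) (Sum.inl v)
      (Sum.inr ()) p :=
  KPrime.kprimeHolds_of_pendant_y hp (leafExt_leaf ends z) (by rw [leafExt_inr, Sym2.eq_swap])
    Sum.inl_ne_inr Sum.inl_ne_inr Sum.inl_ne_inr Sum.inl_ne_inr Sum.inl_ne_inr
    ((kprimeHolds_leafExt ends z p a₁ a₂ b v z).1 H)

omit [Fintype V] in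
/-- `(K′-T)` with the leaf in the role of `y`. -/
theorem kprimeT_leafExt_y (ends : E → Sym2 V) (z a₁ a₂ b v : V) (p : E ⊕ Unit → R)
    (hp : IsProbVec p) (H : KPrime.KPrimeTHolds ends a₁ a₂ b v z (p ∘ Sum.inl)) :
    KPrime.KPrimeTHolds (leafExt ends z) (Sum.inl a₁) (Sum.inl a₂) (Sum.inl b) (Sum.inl v)
      (Sum.inr ()) p :=
  KPrime.kprimeTHolds_of_pendant_y hp (leafExt_leaf ends z) (by rw [leafExt_inr, Sym2.eq_swap])
    Sum.inl_ne_inr Sum.inl_ne_inr Sum.inl_ne_inr Sum.inl_ne_inr Sum.inl_ne_inr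
    ((kprimeTHolds_leafExt ends z p a₁ a₂ b v z).1 H)

end General

section Cycles

variable {R : Type*} [Field R] [LinearOrder R] [IsStrictOrderedRing R]

/-- **`(K′)` on the `n`-cycle with `b` hung by a leaf edge on an unmarked vertex `z`.** -/
theorem kprime_cycle_leaf_b {n : ℕ} [NeZero n] (z a₁ a₂ v y : Fin n) (p : Fin n ⊕ Unit → R)
    (hp : IsProbVec p) (h12 : a₁ ≠ a₂) (h1z : a₁ ≠ z) (h1v : a₁ ≠ v) (h1y : a₁ ≠ y)
    (h2z : a₂ ≠ z) (h2v : a₂ ≠ v) (h2y : a₂ ≠ y) (hzv : z ≠ v) (hzy : z ≠ y) (hvy : v ≠ y) :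
    KPrime.KPrimeHolds (leafExt (cycN n) z) (Sum.inl a₁) (Sum.inl a₂) (Sum.inr ()) (Sum.inl v)
      (Sum.inl y) p :=
  kprime_leafExt_b (cycN n) z a₁ a₂ v y p hp
    (kprime_cycle (p ∘ Sum.inl) ⟨fun _ => hp.nonneg _, fun _ => hp.le_one _⟩ a₁ a₂ z v y
      h12 h1z h1v h1y h2z h2v h2y hzv hzy hvy)

/-- **`(K′)` on the `n`-cycle with `y` hung by a leaf edge on an unmarked vertex `z`.** -/
theorem kprime_cycle_leaf_y {n : ℕ} [NeZero n] (z a₁ a₂ b v : Fin n) (p : Fin n ⊕ Unit → R)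
    (hp : IsProbVec p) (h12 : a₁ ≠ a₂) (h1b : a₁ ≠ b) (h1v : a₁ ≠ v) (h1z : a₁ ≠ z)
    (h2b : a₂ ≠ b) (h2v : a₂ ≠ v) (h2z : a₂ ≠ z) (hbv : b ≠ v) (hbz : b ≠ z) (hvz : v ≠ z) :
    KPrime.KPrimeHolds (leafExt (cycN n) z) (Sum.inl a₁) (Sum.inl a₂) (Sum.inl b) (Sum.inl v)
      (Sum.inr ()) p :=
  kprime_leafExt_y (cycN n) z a₁ a₂ b v p hp
    (kprime_cycle (p ∘ Sum.inl) ⟨fun _ => hp.nonneg _, fun _ => hp.le_one _⟩ a₁ a₂ b v z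
      h12 h1b h1v h1z h2b h2v h2z hbv hbz hvz)

/-- **`(K′-T)` on the `n`-cycle with `b` hung by a leaf edge on an unmarked vertex `z`.** -/
theorem kprimeT_cycle_leaf_b {n : ℕ} [NeZero n] (z a₁ a₂ v y : Fin n) (p : Fin n ⊕ Unit → R)
    (hp : IsProbVec p) (h12 : a₁ ≠ a₂) (h1z : a₁ ≠ z) (h1v : a₁ ≠ v) (h1y : a₁ ≠ y)
    (h2z : a₂ ≠ z) (h2v : a₂ ≠ v) (h2y : a₂ ≠ y) (hzv : z ≠ v) (hzy : z ≠ y) (hvy : v ≠ y) :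
    KPrime.KPrimeTHolds (leafExt (cycN n) z) (Sum.inl a₁) (Sum.inl a₂) (Sum.inr ()) (Sum.inl v)
      (Sum.inl y) p :=
  kprimeT_leafExt_b (cycN n) z a₁ a₂ v y p hp
    (kprimeT_cycle (p ∘ Sum.inl) ⟨fun _ => hp.nonneg _, fun _ => hp.le_one _⟩ a₁ a₂ z v y
      h12 h1z h1v h1y h2z h2v h2y hzv hzy hvy)

/-- **`(K′-T)` on the `n`-cycle with `y` hung by a leaf edge on an unmarked vertex `z`.** -/
theorem kprimeT_cycle_leaf_y {n : ℕ} [NeZero n] (z a₁ a₂ b v : Fin n) (p : Fin n ⊕ Unit → R)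
    (hp : IsProbVec p) (h12 : a₁ ≠ a₂) (h1b : a₁ ≠ b) (h1v : a₁ ≠ v) (h1z : a₁ ≠ z)
    (h2b : a₂ ≠ b) (h2v : a₂ ≠ v) (h2z : a₂ ≠ z) (hbv : b ≠ v) (hbz : b ≠ z) (hvz : v ≠ z) :
    KPrime.KPrimeTHolds (leafExt (cycN n) z) (Sum.inl a₁) (Sum.inl a₂) (Sum.inl b) (Sum.inl v)
      (Sum.inr ()) p :=
  kprimeT_leafExt_y (cycN n) z a₁ a₂ b v p hp
    (kprimeT_cycle (p ∘ Sum.inl) ⟨fun _ => hp.nonneg _, fun _ => hp.le_one _⟩ a₁ a₂ b v z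
      h12 h1b h1v h1z h2b h2v h2z hbv hbz hvz)

end Cycles

section Necklaces

variable {V : Type*} {E : Type*} [Fintype E] [DecidableEq E] [Fintype V] [DecidableEq V]
  {R : Type*} [Field R] [LinearOrder R] [IsStrictOrderedRing R]
variable {ends : E → Sym2 V} {q : Fin 5 → V} {blk : E → Fin 5} {Vj : Fin 5 → Set V}

omit [Fintype V] in
/-- **`(K′)` on a necklace with `b` hung by a leaf edge on its fifth mark `q kz`.** -/
theorem kprime_necklace_leaf_b (hN : IsNecklace ends q blk Vj) (kz k₁ k₂ kv ky : Fin 5)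
    (p : E ⊕ Unit → R) (hp : IsProbVec p) (h12 : k₁ ≠ k₂) (h1z : k₁ ≠ kz) (h1v : k₁ ≠ kv)
    (h1y : k₁ ≠ ky) (h2z : k₂ ≠ kz) (h2v : k₂ ≠ kv) (h2y : k₂ ≠ ky) (hzv : kz ≠ kv)
    (hzy : kz ≠ ky) (hvy : kv ≠ ky) :
    KPrime.KPrimeHolds (leafExt ends (q kz)) (Sum.inl (q k₁)) (Sum.inl (q k₂)) (Sum.inr ())
      (Sum.inl (q kv)) (Sum.inl (q ky)) p :=
  kprime_leafExt_b ends (q kz) (q k₁) (q k₂) (q kv) (q ky) p hp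
    (kprime_necklace hN (p ∘ Sum.inl) ⟨fun _ => hp.nonneg _, fun _ => hp.le_one _⟩ k₁ k₂ kz kv ky
      h12 h1z h1v h1y h2z h2v h2y hzv hzy hvy)

omit [Fintype V] in
/-- **`(K′)` on a necklace with `y` hung by a leaf edge on its fifth mark `q kz`.** -/
theorem kprime_necklace_leaf_y (hN : IsNecklace ends q blk Vj) (kz k₁ k₂ kb kv : Fin 5)
    (p : E ⊕ Unit → R) (hp : IsProbVec p) (h12 : k₁ ≠ k₂) (h1b : k₁ ≠ kb) (h1v : k₁ ≠ kv)
    (h1z : k₁ ≠ kz) (h2b : k₂ ≠ kb) (h2v : k₂ ≠ kv) (h2z : k₂ ≠ kz) (hbv : kb ≠ kv)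
    (hbz : kb ≠ kz) (hvz : kv ≠ kz) :
    KPrime.KPrimeHolds (leafExt ends (q kz)) (Sum.inl (q k₁)) (Sum.inl (q k₂)) (Sum.inl (q kb))
      (Sum.inl (q kv)) (Sum.inr ()) p :=
  kprime_leafExt_y ends (q kz) (q k₁) (q k₂) (q kb) (q kv) p hp
    (kprime_necklace hN (p ∘ Sum.inl) ⟨fun _ => hp.nonneg _, fun _ => hp.le_one _⟩ k₁ k₂ kb kv kz
      h12 h1b h1v h1z h2b h2v h2z hbv hbz hvz)

end Necklaces

end KPrimeCycle

end Summit.Ventures.PercRepro2
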